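import Summits.QuantumAdvantage.QuantumAdvantage.Theorems.WbwVerifiableLineNoSpeedup.Negative.QueryReindex
import Literature.Computability.QuantumComplexity.SinkOfVerifiableLine

/-!
# Padding monotonicity of black-box SVL: `Q_ε(SVL_{m,T'}) ≤ Q_ε(SVL_{m+1,T})` for `T' < T ≤ 2^m`

Support lemma for the crux `WhiteBoxWalk.WbwVerifiableLineNoSpeedup` (stmt-QuantumAdvantage-2239),
from the refuter work file `Cruxes/WbwVerifiableLineNoSpeedup/Disproof.lean` §7.2 (the second
ingredient of the checked reduction `crux_of_smallT_of_padding`). An `(m, T')` instance `t` on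
names `[2^m]` becomes an `(m+1, T)` instance on names `[2^(m+1)]`: the line is the fresh prefix
`0, 1, …, P-1` (`P = T - T' ≥ 1`, low half) followed by the old line shifted to the high half,
`2^m + x_0, …, 2^m + x_{T'}` (`2^m + x` has the parity of `x`); `S(2^m + x) = 2^m + S(x)`,
`V(2^m + x, i) = V(x, i - P)`, everything else constant. Every bit of the big table is a COPY of a
bit of the small table (`padSrc`), the constants being copied from the bits `V(0,0) = 1` and
`V(1,0) = 0`, which are constant ON THE PROMISE; so `QueryReindex.quantumQueryComplexityOn_le_of_reindex`
applies (`quantumQueryComplexityOn_svl_pad`). Sorry-free.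
-/

noncomputable section

set_option linter.dupNamespace false

namespace Summit.QuantumAdvantage.QuantumAdvantage.Theorems.WbwVerifiableLineNoSpeedup.Negative.SvlPadding

open Literature.Computability.Cryptography Literature.Computability.QuantumComplexity
  Literature.Computability.Complexity
open Summit.QuantumAdvantage.QuantumAdvantage.Theorems.WbwVerifiableLineNoSpeedup.Negative.QueryReindex

variable {m T T' : ℕ}

/-- Position of the bit `V(0,0)` of the small table (constantly `1` on the promise). [folklore] -/
def onePos (m T' : ℕ) : Fin (2 ^ m * m + 2 ^ m * (T' + 1)) :=
  svlVerifyIndex m T' ⟨0, Nat.two_pow_pos m⟩ 0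

/-- Position of the bit `V(1,0)` of the small table (constantly `0` on the promise; `m ≥ 1`). [folklore] -/
def zeroPos (m T' : ℕ) (hm : 1 ≤ m) : Fin (2 ^ m * m + 2 ^ m * (T' + 1)) :=
  svlVerifyIndex m T' ⟨1, Nat.one_lt_two_pow (by omega)⟩ 0

/-- A position of the small table carrying the constant `b` on the promise. [folklore] -/
def constPos (m T' : ℕ) (hm : 1 ≤ m) (b : Bool) : Fin (2 ^ m * m + 2 ^ m * (T' + 1)) :=
  if b then onePos m T' else zeroPos m T' hm

/-- The successor of a low-half row `X < 2^m` of the big instance: `X + 1` inside the fresh prefix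
`0, …, P-1`, the jump `2^m` at its end, `0` elsewhere. [folklore] -/
def lowSuccVal (m P X : ℕ) : ℕ := if X + 1 < P then X + 1 else if X + 1 = P then 2 ^ m else 0

/-- `2^(m+1) = 2^m + 2^m`. [folklore] -/
theorem two_pow_succ_eq (m : ℕ) : 2 ^ (m + 1) = 2 ^ m + 2 ^ m := by rw [pow_succ]; ring

/-- Source map for the S-table of the big instance. [folklore] -/
def padSrcS (hm : 1 ≤ m) (P : ℕ) (k : Fin (2 ^ (m + 1) * (m + 1))) :
    Fin (2 ^ m * m + 2 ^ m * (T' + 1)) :=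
  if hX : 2 ^ m ≤ ((finProdFinEquiv.symm k).1).val then
    if hj : ((finProdFinEquiv.symm k).2).val < m then
      svlSuccIndex m T' ⟨((finProdFinEquiv.symm k).1).val - 2 ^ m, by
        have := ((finProdFinEquiv.symm k).1).isLt; have h2 := two_pow_succ_eq m; omega⟩
        ⟨_, hj⟩
    else onePos m T'
  else constPos m T' hm ((lowSuccVal m P ((finProdFinEquiv.symm k).1).val).testBit
    ((finProdFinEquiv.symm k).2).val)

/-- Source map for the V-table of the big instance. [folklore] -/
def padSrcV (hm : 1 ≤ m) (P : ℕ) (k : Fin (2 ^ (m + 1) * (T + 1))) :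
    Fin (2 ^ m * m + 2 ^ m * (T' + 1)) :=
  if ((finProdFinEquiv.symm k).2).val < P then
    constPos m T' hm (decide (((finProdFinEquiv.symm k).1).val = ((finProdFinEquiv.symm k).2).val))
  else if hX : 2 ^ m ≤ ((finProdFinEquiv.symm k).1).val then
    if hi : ((finProdFinEquiv.symm k).2).val - P < T' + 1 then
      svlVerifyIndex m T' ⟨((finProdFinEquiv.symm k).1).val - 2 ^ m, by
        have := ((finProdFinEquiv.symm k).1).isLt; have h2 := two_pow_succ_eq m; omega⟩
        ⟨_, hi⟩
    else zeroPos m T' hm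
  else zeroPos m T' hm

/-- **The padding source map**: every bit of the big `(m+1, T)` table is a copy of a bit of the
small `(m, T')` table (`P = T - T'` fresh prefix vertices). [folklore] -/
def padSrc (hm : 1 ≤ m) (P : ℕ) :
    Fin (2 ^ (m + 1) * (m + 1) + 2 ^ (m + 1) * (T + 1)) → Fin (2 ^ m * m + 2 ^ m * (T' + 1)) :=
  Fin.append (padSrcS (T' := T') hm P) (padSrcV (T := T) (T' := T') hm P)

/-- The padded line: `0, 1, …, P-1` then `2^m + x_0, …, 2^m + x_{T'}`. [folklore] -/
def padLine (P : ℕ) (hPT : P + T' = T) (hPm : P ≤ 2 ^ m) (xs : Fin (T' + 1) → Fin (2 ^ m))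
    (i : Fin (T + 1)) : Fin (2 ^ (m + 1)) :=
  if h : i.val < P then ⟨i.val, by have h2 := two_pow_succ_eq m; omega⟩
  else ⟨2 ^ m + (xs ⟨i.val - P, by have := i.isLt; omega⟩).val, by
    rw [two_pow_succ_eq]; exact Nat.add_lt_add_left (Fin.isLt _) _⟩

section Reading

variable (hm : 1 ≤ m) (P : ℕ) (t : SVLInput m T')

/-- Reading an S-bit of the padded table. [folklore] -/
theorem svlSuccBit_pad (X : Fin (2 ^ (m + 1))) (j : Fin (m + 1)) :
    svlSuccBit (t ∘ padSrc (T := T) hm P) X j = t (padSrcS hm P (finProdFinEquiv (X, j))) := by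
  simp only [svlSuccBit, svlSuccIndex, Function.comp_apply, padSrc, Fin.append_left]

/-- Reading a V-bit of the padded table. [folklore] -/
theorem svlVerify_pad (X : Fin (2 ^ (m + 1))) (i : Fin (T + 1)) :
    svlVerify (t ∘ padSrc (T' := T') hm P) X i = t (padSrcV hm P (finProdFinEquiv (X, i))) := by
  simp only [svlVerify, svlVerifyIndex, Function.comp_apply, padSrc, Fin.append_right]

variable {t} {xs : Fin (T' + 1) → Fin (2 ^ m)} (h : IsSvlLine t xs)
include h

/-- The source as an element of `Fin (2^m)`. [folklore] -/
theorem xs_zero_eq : xs 0 = ⟨0, Nat.two_pow_pos m⟩ := Fin.ext h.source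

/-- On the promise `V(0,0) = 1`. [folklore] -/
theorem apply_onePos : t (onePos m T') = true := by
  change svlVerify t _ _ = true
  rw [h.svlVerify_eq_true_iff, xs_zero_eq h]

/-- On the promise `V(1,0) = 0` (`m ≥ 1`). [folklore] -/
theorem apply_zeroPos : t (zeroPos m T' hm) = false := by
  change svlVerify t _ _ = false
  rw [Bool.eq_false_iff, ne_eq, h.svlVerify_eq_true_iff, xs_zero_eq h]
  simp

/-- On the promise the constant positions carry their constants. [folklore] -/
theorem apply_constPos (b : Bool) : t (constPos m T' hm b) = b := by
  cases b
  · exact apply_zeroPos hm h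
  · exact apply_onePos h

end Reading

/-- **The padded instance is in the big promise set.** [folklore] -/
theorem isSvlLine_pad (hm : 1 ≤ m) {P : ℕ} (hP : 1 ≤ P) (hPT : P + T' = T) (hPm : P ≤ 2 ^ m)
    {t : SVLInput m T'} {xs : Fin (T' + 1) → Fin (2 ^ m)} (h : IsSvlLine t xs) :
    IsSvlLine (t ∘ padSrc (T := T) hm P) (padLine P hPT hPm xs) := by
  have h1 := apply_onePos h
  have h0 := apply_zeroPos hm h
  have hc := apply_constPos hm h
  refine ⟨?_, ?_, ?_, ?_⟩
  · -- injective
    intro i i' hii'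
    unfold padLine at hii'
    by_cases hi : i.val < P <;> by_cases hi' : i'.val < P
    · rw [dif_pos hi, dif_pos hi'] at hii'
      exact Fin.ext (Fin.mk.inj_iff.1 hii')
    · rw [dif_pos hi, dif_neg hi'] at hii'
      have := Fin.mk.inj_iff.1 hii'
      omega
    · rw [dif_neg hi, dif_pos hi'] at hii'
      have := Fin.mk.inj_iff.1 hii'
      omega
    · rw [dif_neg hi, dif_neg hi'] at hii'
      have h2 := Fin.mk.inj_iff.1 hii'
      have h3 : xs ⟨i.val - P, by have := i.isLt; omega⟩ = xs ⟨i'.val - P, by have := i'.isLt; omega⟩ :=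
        Fin.ext (by omega)
      have h4 := Fin.mk.inj_iff.1 (h.injective h3)
      exact Fin.ext (by omega)
  · -- source
    unfold padLine
    rw [dif_pos (by simp; omega)]
    rfl
  · -- successor
    intro i j
    rw [svlSuccBit_pad]
    unfold padSrcS
    simp only [Equiv.symm_apply_apply]
    by_cases hi : (i.castSucc : Fin (T + 1)).val < P
    · -- low-half row `X = i`
      have hXval : (padLine P hPT hPm xs i.castSucc).val = i.val := by
        unfold padLine; rw [dif_pos hi]; rfl
      have hiP : i.val < P := by simpa using hi
      have hlow : ¬ 2 ^ m ≤ (padLine P hPT hPm xs i.castSucc).val := by rw [hXval]; omega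
      rw [dif_neg hlow, hc, hXval]
      congr 1
      -- value of the successor
      unfold lowSuccVal padLine
      by_cases hi1 : i.val + 1 < P
      · rw [if_pos hi1, dif_pos (by simpa using hi1)]
        simp
      · have hi2 : i.val + 1 = P := by omega
        rw [if_neg hi1, if_pos hi2, dif_neg (by simp; omega)]
        simp only [Fin.val_succ]
        have : (⟨i.val + 1 - P, by have := i.isLt; omega⟩ : Fin (T' + 1)) = 0 := Fin.ext (by simp; omega)
        rw [this, xs_zero_eq h]
        rfl
    · -- high-half row `X = 2^m + xs (i - P)`
      have hiP : P ≤ i.val := by simpa using hi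
      have hXval : (padLine P hPT hPm xs i.castSucc).val = 2 ^ m + (xs ⟨i.val - P, by have := i.isLt; omega⟩).val := by
        unfold padLine; rw [dif_neg hi]; rfl
      have hhigh : 2 ^ m ≤ (padLine P hPT hPm xs i.castSucc).val := by rw [hXval]; omega
      rw [dif_pos hhigh]
      have hsucc : (padLine P hPT hPm xs i.succ).val = 2 ^ m + (xs ⟨i.val + 1 - P, by have := i.isLt; omega⟩).val := by
        unfold padLine; rw [dif_neg (by simp; omega)]; rfl
      rw [hsucc]
      by_cases hj : j.val < m
      · rw [dif_pos hj]
        -- old successor bit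
        have hidx : i.val - P < T' := by have := i.isLt; omega
        have hold := h.2.2.1 ⟨i.val - P, hidx⟩ ⟨j.val, hj⟩
        have hrow : (⟨(padLine P hPT hPm xs i.castSucc).val - 2 ^ m, by
            have := (padLine P hPT hPm xs i.castSucc).isLt; have h2 := two_pow_succ_eq m; omega⟩ :
              Fin (2 ^ m)) = xs (Fin.castSucc ⟨i.val - P, hidx⟩) := by
          apply Fin.ext
          rw [Fin.val_mk, hXval, Nat.add_sub_cancel_left]
          rfl
        have hsucc' : Fin.succ ⟨i.val - P, hidx⟩ =
            (⟨i.val + 1 - P, by have := i.isLt; omega⟩ : Fin (T' + 1)) :=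
          Fin.ext (show i.val - P + 1 = i.val + 1 - P by omega)
        unfold svlSuccBit at hold
        rw [hrow, hold, Nat.testBit_two_pow_add_gt hj, hsucc']
      · rw [dif_neg hj, h1]
        have hjm : j.val = m := by have := j.isLt; omega
        rw [hjm, Nat.testBit_two_pow_add_eq, Nat.testBit_lt_two_pow (Fin.isLt _)]
        rfl
  · -- verifier
    intro X i
    rw [svlVerify_pad]
    unfold padSrcV
    simp only [Equiv.symm_apply_apply]
    by_cases hi : i.val < P
    · rw [if_pos hi, hc]
      unfold padLine
      rw [dif_pos hi]
      by_cases hXi : X.val = i.val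
      · rw [decide_eq_true hXi, eq_comm, decide_eq_true (Fin.ext hXi)]
      · rw [decide_eq_false hXi, eq_comm, decide_eq_false]
        intro hh; exact hXi (congrArg Fin.val hh)
    · rw [if_neg hi]
      have hiP : P ≤ i.val := by omega
      have hidx : i.val - P < T' + 1 := by have := i.isLt; omega
      by_cases hX : 2 ^ m ≤ X.val
      · rw [dif_pos hX, dif_pos hidx]
        change svlVerify t _ _ = _
        rw [h.2.2.2]
        unfold padLine
        rw [dif_neg hi]
        by_cases hXe : (⟨X.val - 2 ^ m, by have := X.isLt; have h2 := two_pow_succ_eq m; omega⟩ : Fin (2 ^ m))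
            = xs ⟨i.val - P, hidx⟩
        · rw [decide_eq_true hXe, eq_comm, decide_eq_true]
          apply Fin.ext
          have := congrArg Fin.val hXe
          simp at this ⊢
          omega
        · rw [decide_eq_false hXe, eq_comm, decide_eq_false]
          intro hh
          apply hXe
          apply Fin.ext
          have := congrArg Fin.val hh
          simp at this ⊢
          omega
      · rw [dif_neg hX, h0, eq_comm]
        symm
        rw [decide_eq_false]
        intro hh
        have := congrArg Fin.val hh
        unfold padLine at this
        rw [dif_neg hi] at this
        simp at this
        omega

/-- Hence padding maps the small promise into the big one … [folklore] -/
theorem pad_mem (hm : 1 ≤ m) {P : ℕ} (hP : 1 ≤ P) (hPT : P + T' = T) (hPm : P ≤ 2 ^ m)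
    {t : SVLInput m T'} (ht : t ∈ svlPromise m T') :
    t ∘ padSrc (T := T) hm P ∈ svlPromise (m + 1) T := by
  obtain ⟨xs, h⟩ := ht
  exact ⟨_, isSvlLine_pad hm hP hPT hPm h⟩

/-- … preserving the sink bit (`2^m + x` has the parity of `x`). [folklore] -/
theorem svlSinkBit_pad (hm : 1 ≤ m) {P : ℕ} (hP : 1 ≤ P) (hPT : P + T' = T) (hPm : P ≤ 2 ^ m)
    {t : SVLInput m T'} (ht : t ∈ svlPromise m T') :
    svlSinkBit (m + 1) T (t ∘ padSrc (T := T) hm P) = svlSinkBit m T' t := by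
  obtain ⟨xs, h⟩ := ht
  rw [(isSvlLine_pad hm hP hPT hPm h).svlSinkBit_eq, h.svlSinkBit_eq]
  have hval : (padLine P hPT hPm xs (Fin.last T)).val = 2 ^ m + (xs (Fin.last T')).val := by
    unfold padLine
    rw [dif_neg (by simp; omega), Fin.val_mk,
      show (⟨(Fin.last T).val - P, by simp; omega⟩ : Fin (T' + 1)) = Fin.last T' from
        Fin.ext (by simp; omega)]
  rw [hval]
  have h2 : (2 ^ m) % 2 = 0 := by
    obtain ⟨m', rfl⟩ : ∃ m', m = m' + 1 := ⟨m - 1, by omega⟩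
    rw [pow_succ]; omega
  congr 1
  apply propext
  constructor <;> intro hh <;> omega

/-- The SVL input length is nonzero. [folklore] -/
instance instNeZeroSvlLen' (m T : ℕ) : NeZero (2 ^ m * m + 2 ^ m * (T + 1)) :=
  ⟨(Nat.add_pos_right _ (Nat.mul_pos (Nat.two_pow_pos m) (Nat.succ_pos T))).ne'⟩

/-- **Padding monotonicity**: `Q_{ε}(SVL_{m,T'}) ≤ Q_{ε}(SVL_{m+1,T})` for `1 ≤ m` and
`T' < T ≤ 2^m` (`0 ≤ ε`). [folklore] -/
theorem quantumQueryComplexityOn_svl_pad {ε : ℝ} (hε : 0 ≤ ε) (hm : 1 ≤ m) (hT : T' < T)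
    (hTm : T ≤ 2 ^ m) :
    quantumQueryComplexityOn ε (svlPromise m T') (svlSinkBit m T') ≤
      quantumQueryComplexityOn ε (svlPromise (m + 1) T) (svlSinkBit (m + 1) T) :=
  quantumQueryComplexityOn_le_of_reindex hε (padSrc (T := T) (T' := T') hm (T - T'))
    (fun _ ht => pad_mem hm (by omega) (by omega) (by omega) ht)
    (fun _ ht => svlSinkBit_pad hm (by omega) (by omega) (by omega) ht)

end Summit.QuantumAdvantage.QuantumAdvantage.Theorems.WbwVerifiableLineNoSpeedup.Negative.SvlPadding
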